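import Summits.Ventures.QEC.Census.CertBZPlane
import Summits.Ventures.QEC.Census.TwoBGA.A1p_n192_k12_0002ed2e.Cert
import HarnessLib

/-!
# `A1p_n192_k12_0002ed2e` — lane-engine replays, part 7/7 (census row `A1p_n192_k12_0002ed2e`; qec-search-4 g4 orbit lane)

`Plane.segOK` verdicts (type-01 lane engine, `decide +kernel`) for segments of the kernel-basis replays of the views of
`Census/TwoBGA/A1p_n192_k12_0002ed2e/`; assembled in `Distance.lean`.  Generated by `tools/gen4/emit_orbit_row.py`; do not edit by hand.
-/

set_option autoImplicit false
set_option Elab.async false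

namespace Summit.Ventures.QEC.Census.A1p_n192_k12_0002ed2e

open Summit.Ventures.QEC.Census

set_option maxHeartbeats 400000000 in
/-- `X` view 0, lane segment `[96, 97)` (3469497 lanes, depth 5, threshold 11; est 36 s): every selection with largest row there passes (lane engine, KERNEL). -/
theorem psegX_0_62 : Plane.segOK 192 11 (A1p_n192_k12_0002ed2e.cert.sideX.found.map Prod.fst) A1p_n192_k12_0002ed2e.pGX_0 5 96 1 16 = true := by
  decide +kernel

set_option maxHeartbeats 400000000 in
/-- `X` view 0, lane segment `[97, 98)` (3617034 lanes, depth 5, threshold 11; est 35 s): every selection with largest row there passes (lane engine, KERNEL). -/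
theorem psegX_0_63 : Plane.segOK 192 11 (A1p_n192_k12_0002ed2e.cert.sideX.found.map Prod.fst) A1p_n192_k12_0002ed2e.pGX_0 5 97 1 16 = true := by
  decide +kernel

set_option maxHeartbeats 400000000 in
/-- `X` view 0, lane segment `[98, 99)` (3769228 lanes, depth 5, threshold 11; est 37 s): every selection with largest row there passes (lane engine, KERNEL). -/
theorem psegX_0_64 : Plane.segOK 192 11 (A1p_n192_k12_0002ed2e.cert.sideX.found.map Prod.fst) A1p_n192_k12_0002ed2e.pGX_0 5 98 1 16 = true := by
  decide +kernel

set_option maxHeartbeats 400000000 in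
/-- `X` view 0, lane segment `[99, 100)` (3926176 lanes, depth 5, threshold 11; est 38 s): every selection with largest row there passes (lane engine, KERNEL). -/
theorem psegX_0_65 : Plane.segOK 192 11 (A1p_n192_k12_0002ed2e.cert.sideX.found.map Prod.fst) A1p_n192_k12_0002ed2e.pGX_0 5 99 1 16 = true := by
  decide +kernel

set_option maxHeartbeats 400000000 in
/-- `X` view 0, lane segment `[100, 101)` (4087976 lanes, depth 5, threshold 11; est 39 s): every selection with largest row there passes (lane engine, KERNEL). -/
theorem psegX_0_66 : Plane.segOK 192 11 (A1p_n192_k12_0002ed2e.cert.sideX.found.map Prod.fst) A1p_n192_k12_0002ed2e.pGX_0 5 100 1 16 = true := by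
  decide +kernel

set_option maxHeartbeats 400000000 in
/-- `X` view 0, lane segment `[101, 102)` (4254727 lanes, depth 5, threshold 11; est 47 s): every selection with largest row there passes (lane engine, KERNEL). -/
theorem psegX_0_67 : Plane.segOK 192 11 (A1p_n192_k12_0002ed2e.cert.sideX.found.map Prod.fst) A1p_n192_k12_0002ed2e.pGX_0 5 101 1 16 = true := by
  decide +kernel

end Summit.Ventures.QEC.Census.A1p_n192_k12_0002ed2e
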